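import Literature.NumberTheory.EllipticCurves.Castella2018.AnticyclotomicMainConjectureErratum
import Literature.NumberTheory.EllipticCurves.PAdicGrossZagierConstantTermProofs
import Summits.BirchSwinnertonDyer.Rank1Residual.X11b.RouteOpenInputsAgree
import Summits.BirchSwinnertonDyer.Rank1Residual.X11b.RouteR1BDPValueCoreFrame
import Summits.BirchSwinnertonDyer.Rank1Residual.X11b.RouteR1HalvesAllFrames
import Summits.BirchSwinnertonDyer.Rank1Residual.X11b.BDPRouteOpenInputFromLever
import Summits.BirchSwinnertonDyer.Rank1Residual.X11b.BDPRouteErratumDataRecord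
import HarnessLib

/-!
# Route `ErratumRoadFive`, crux `OpenInputIMC` (item stmt-BirchSwinnertonDyer-19061): the erratum's
# Thm. 1.1 AS A CITATION — the pointwise handshake, the ♭-core shape and the `BSD(E,p)` reading on the
# semistable part of `R1Population` (seat `bsd-stepL-imc-t1`'s companion theorems, landed by `imc-p1`)

Cell `bsd-stepL` (run/shared/lean/pub/bsd-stepL/). AUTHORSHIP: this file is the ready-to-land Theorems
companion written by the literature typer seat `bsd-stepL-imc-t1` (HOME `imc-t1/`, item evidence on
19061, sha16 08f136f976f31dbb; a typer cannot write under `Theorems/`, `perm.theorems-prover-only`),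
landed by the prover seat `bsd-stepL-imc-p1` `--supports stmt-BirchSwinnertonDyer-19061` with the SIX
declarations REMOVED whose fully-qualified names (or exact content) already exist in the tree through
`Theorems/ErratumRoadFiveOpenInputIMCFromErratumFact.lean` (imc-p1, p418951 — the two seats' bridge
files crossed on the bus at 02:54–03:12Z): `imcEqAllFramesOnTree_of_erratumThm11_OPEN`,
`imcEqCoreFrameOnTree_of_erratumThm11_OPEN`, `imcDivIntCoreFrameAtErratumData_of_erratumThm11_OPEN`,
`openInputOnTreeAt_of_r1Population_of_semistable_of_erratumThm11_OPEN`,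
`openInputIMC_r1Semistable_of_erratumThm11_OPEN` (same names there) and
`openInputOnTreeAt_of_r1Population_of_not_dvd_of_valueCoreFrame_of_erratumThm11_OPEN` (=
`openInputOnTreeAt_of_r1Population_of_not_dvd_of_bdpValueCoreFrame_of_erratumThm11_OPEN` there). What
remains is imc-t1's text VERBATIM except that the `BSD(E,p)` reading derives route R1's ∃-core shape
inline from the pointwise handshake (three lines) instead of calling the removed declaration.

HONEST FRAMING: nothing here proves the crux unconditionally; BSD is proved for no pair by this; the
Literature fact `Castella2018.erratumThm11_exists_isBDPLFunction_isTorsion_charIdeal_eq_OPEN`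
(imc-t1, p417695) is an explicitly labelled OPEN hypothesis transcribing an UNREFEREED source
(Castella's web erratum Thm. 1.1 = Castella arXiv:2409.01360 Thm. 3.1; its upper divisibility (2.4)
is Fouquet–Wan arXiv:2107.13726 Thm. 4.41, unrefereed); every published ∕ cited named fact is a
HYPOTHESIS. THEOREMS ONLY (no definition, no named fact, no `sorry`); pure composition of landed
kernels (multr1-p1 gens 20–26, multr1-p2 gen 28, bdp p408571).

## What this file proves

* §1 **`exists_frame_imcEqOnTreeAt_of_erratumThm11_OPEN`** — the POINTWISE handshake: at an erratum
  datum (`ErratumHypotheses W p`, a non-split multiplicative `q ≠ p` with `E[p]` ramified, an erratum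
  field `K` for `q`, `d_K ≡ β² (mod 4N_E)`), for EVERY newform `f` of `E` (not only the datum's
  `f_{Dt}`), every anticyclotomic `(κ, γ)`, every embedding datum `ι'` and infinite place `w₀`: an
  `R₀`-frame `(Ω_K ≠ 0, Ω_p ∈ R₀ˣ, L)` with Castella's interpolation property at `𝔭_{ι'}` AND
  `R1.IMCEqOnTreeAt W p κ 𝔭_{ι'} γ L`. Mechanism: Thm. 1.1's hypotheses (i)–(iv) hold at the datum
  (`X11b.thm11Hypotheses_of_isErratumField`; `p ∣ N_E` splits; `q ∣ d_K` does not split —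
  `not_dvd_discr_of_ncard_primesOver`); the fact is read at THE prime `𝔭_{ι'}`
  (`forall_mem_primeOfEmbeddingDatum_iff`) along THE structure map `toUnr` (`coe_toUnr`), on the
  Literature `X_ac`, which IS the cell's `X_ac` (same term).
  **`imcEqIntCoreFrameOnTree_of_erratumThm11_OPEN`** — H3∃♭⁻ = `R1.IMCEqIntCoreFrameOnTree W p` for
  every `(W, p)`, WITHOUT H2 (the fact carries its own frame; `R₀ → 𝓞_{ℂ_p}`).
* §2 **`bsdp_of_r1Population_of_semistable_of_erratumThm11_OPEN`** — the `BSD(E,p)` READING on the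
  SEMISTABLE part of `R1Population` from citations: the OPEN fact + Cas18 Thms. 3.1–3.2 (`h32`) + 7
  further PUBLISHED + 5 CITED facts (route R1's equality record
  `R1.bsdp_of_bdpValueCoreFrame_of_imcEqCoreFrame_record`). Census: semistable part of `R1Population`
  = 555 199 of the 2 267 348 X11b-shape pairs at `p ≥ 5`, `N < 5·10⁵` (multr1-p1 `census500k`).

CONDITIONAL; nothing booked; no label changes; closes rung K2 of BirchSwinnertonDyer for NO pair.

References: [Castella2018Erratum] Thm. 1.1 (p. 1), Thm. 2.3, (2.4) (pp. 3–4); [Castella2024]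
arXiv:2409.01360 Thm. 3.1; [FouquetWan2021] arXiv:2107.13726 Thm. 4.41 (PREPRINT); [Castella2018]
Def. 2.2, Thms. 2.3, 3.1, 3.2, §5 (arXiv:1704.06608 pp. 5, 9, 12); [Miller2011LMS] Def. 1.1.
-/

set_option autoImplicit false

noncomputable section

open scoped Classical

open WeierstrassCurve NumberField IsDedekindDomain Field
open Literature.NumberTheory.EllipticCurves Literature.NumberTheory.EllipticCurves.GreenbergSelmer
open Literature.NumberTheory.EllipticCurves.ModularForms
open Literature.NumberTheory.EllipticCurves.Rank1Residual
open Literature.NumberTheory.EllipticCurves.Rank1Residual.Typed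
open Literature.NumberTheory.EllipticCurves.Wuthrich2014
open Literature.NumberTheory.EllipticCurves.Castella2018
open Literature.NumberTheory.GaloisRepresentations
open Literature.NumberTheory.GaloisCohomology
open Summit.BirchSwinnertonDyer.Rank1Residual Summit.BirchSwinnertonDyer.Rank1Residual.X11b
open Summit.BirchSwinnertonDyer.Rank1Residual.X11b.Halves

namespace Summit.BirchSwinnertonDyer.BirchSwinnertonDyer.Theorems

/-! ### §1 The pointwise handshake and the ♭-core shape, at every pair -/

section Handshake

variable (W : WeierstrassCurve ℚ) [W.IsElliptic] [W.IsGloballyMinimal] (p : ℕ) [Fact p.Prime]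

/-- **Erratum Thm. 1.1 (OPEN Literature fact) at an erratum datum: an `R₀`-frame carrying the
main-conjecture EQUALITY on the cell's `X_ac`.** For `W/ℚ` globally minimal with `ErratumHypotheses W p`,
a non-split multiplicative `q ≠ p` with `p ∤ v_q(Δ)`, an erratum field `K` for `q`, `d_K ≡ β² (mod 4N_E)`
(a Heegner datum of level `N_E` provides `β`), a newform `f` of `W` at level `N_E`, an anticyclotomic `κ`
with topological generator `γ`, an embedding datum `ι'` and an infinite place `w₀`: IF
`erratumThm11_exists_isBDPLFunction_isTorsion_charIdeal_eq_OPEN` holds, THERE IS a frame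
`(Ω_K ≠ 0, Ω_p ∈ R₀ˣ, L ∈ R₀⟦T⟧)` with `IsBDPLFunction ι' 𝔭_{ι'} κ γ f Ω_K Ω_p L` and
`R1.IMCEqOnTreeAt W p κ 𝔭_{ι'} γ L`. Hypotheses (i)–(iv) of Thm. 1.1 at the datum:
`thm11Hypotheses_of_isErratumField` (with `p` split as `p ∣ N_E`, `p ≠ q`; `q ∣ d_K` non-split;
`Mult W ℓ ⇒ ℓ ∣ N_E`); the prime: `forall_mem_primeOfEmbeddingDatum_iff`; the structure map:
`coe_toUnr`; the Literature `X_ac` is the cell's by `rfl`. CONDITIONAL on the OPEN fact; nothing booked.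
[claim: Castella2018Erratum, status: under-review]
[cite: Castella2018, Def. 2.2 (arXiv:1704.06608 p. 5), Thm. 3.1 (p. 9)] -/
theorem exists_frame_imcEqOnTreeAt_of_erratumThm11_OPEN
    (h11 : erratumThm11_exists_isBDPLFunction_isTorsion_charIdeal_eq_OPEN)
    [NeZero (W.conductorNorm ℤ)] {q : ℕ} [Fact q.Prime] {K : Type} [Field K] [NumberField K]
    (hE : ErratumHypotheses W p) (hqp : q ≠ p) (hmq : Mult W q)
    (hns : ¬ W.HasSplitMultiplicativeReductionAtPrime q)
    (hvq : ¬ p ∣ padicValInt q W.minimalDiscriminantInt) (hK : IsErratumField W K q)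
    (hβ : ∃ β : ℤ, (4 * (W.conductorNorm ℤ) : ℤ) ∣ β ^ 2 - NumberField.discr K)
    (f : CuspForm (CongruenceSubgroup.Gamma0 (W.conductorNorm ℤ)) 2) (hf : IsNewformOf W f)
    (κ : ZpExtension K p) (hκ : κ.IsAnticyclotomic) (γ : Field.absoluteGaloisGroup K)
    [Fact (κ.IsTopGenerator γ)] (ι' : PadicAlgCl p ≃+* ℂ) (w₀ : InfinitePlace K) :
    ∃ (ΩK : ℂ) (Ωp : (unrIntegers p)ˣ) (L : UnrSeries p), ΩK ≠ 0 ∧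
      IsBDPLFunction ι' (primeOfEmbeddingDatum p ι' w₀.embedding) κ γ f ΩK
        ((Ωp : unrIntegers p) : ℂ_[p]) L ∧
      R1.IMCEqOnTreeAt W p κ (primeOfEmbeddingDatum p ι' w₀.embedding) γ L := by
  -- the conductor / reduction dictionary: a multiplicative prime divides `N_E`
  have hN : ∀ (ℓ : ℕ) [Fact ℓ.Prime], Mult W ℓ → ℓ ∣ W.conductorNorm ℤ := fun ℓ _ hℓ ↦
    (W.dvd_conductorNorm_iff_not_hasGoodReductionAtPrime ℓ).mpr
      (WeierstrassCurve.HasMultiplicativeReduction.not_hasGoodReduction (R := ℤ_[ℓ]) hℓ)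
  have hpN : p ∣ W.conductorNorm ℤ := hN p hE.2.1
  -- `p` splits (`p ∣ N_E`, `p ≠ q`); `q ∣ d_K` does not
  have hsp : SplitsIn K p := hK.ncard_primesOver_eq_two (Fact.out) hpN hqp
  have hnq : ¬ SplitsIn K q := fun hs ↦
    Literature.NumberTheory.EllipticCurves.not_dvd_discr_of_ncard_primesOver (K := K) (Fact.out)
      (hs.trans hK.1.1.symm) hK.2.1
  -- hypotheses (i)–(iv) of Thm. 1.1 at this datum
  obtain ⟨-, hmult, hKiq, hβ', hsplit, hirr, h2, hiii, hram, hiv⟩ :=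
    thm11Hypotheses_of_isErratumField hE hqp hmq hns hvq hK hβ hsp hN hnq
  have h3p : 3 < p := by have := hE.1; omega
  have h2' : ((Ideal.span {(2 : ℤ)}).primesOver (𝓞 K)).ncard ≠ 2 → Mult W 2 := fun hne ↦
    h2 (by simpa [SplitsIn] using hne)
  -- the OPEN fact at THE prime `𝔭_{ι'}` of the embedding datum
  obtain ⟨ΩK, Ωp, L, hΩ, hL, -, hEq⟩ :=
    h11 ι' W K (primeOfEmbeddingDatum p ι' w₀.embedding) κ γ hf rfl h3p hmult hKiq hβ' hsplit
      (natCast_mem_primeOfEmbeddingDatum p ι' w₀.embedding)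
      (forall_mem_primeOfEmbeddingDatum_iff p ι' hKiq w₀) hirr h2' hiii hram hiv hκ
  -- the equality along `toUnr`, on the cell's `X_ac` (= the Literature one, by `rfl`)
  exact ⟨ΩK, Ωp, L, hΩ, hL, hEq (toUnr p) (coe_toUnr p)⟩

/-- **H3∃♭⁻ FROM THE CITATION, every pair: `R1.IMCEqIntCoreFrameOnTree W p`** (per erratum datum a
♭-frame `(Ω_K ≠ 0, ‖Ω_p‖ = 1, Q ∈ 𝓞_{ℂ_p}⟦T⟧)` with Castella's interpolation property and
`Ch_Λ(X_ac^∅)·𝓞_{ℂ_p}⟦T⟧ = (Q)`), WITHOUT H2: the fact carries its own frame for the newform `f_{Dt}`;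
read it in `𝓞_{ℂ_p}⟦T⟧` along `R₀ ⊆ 𝓞_{ℂ_p}` (`R1.isBDPLFunctionInt_map`, `R1.imcEqIntAt_map`,
`‖Ω_p‖ = 1` for a unit of `R₀`). Semistable or not; NO other input. CONDITIONAL on the OPEN fact;
nothing booked. [claim: Castella2018Erratum, status: under-review]
[cite: Castella2018, Thm. 3.1 (arXiv:1704.06608 p. 9)] [cite: Hsieh2014, p. 7 (arXiv:1112.1580) (the receptacle)] -/
theorem imcEqIntCoreFrameOnTree_of_erratumThm11_OPEN
    (h11 : erratumThm11_exists_isBDPLFunction_isTorsion_charIdeal_eq_OPEN) :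
    R1.IMCEqIntCoreFrameOnTree W p := by
  intro _ q _ K _ _ Dt H w₀ P hE hr hqp hmq hns hvq hK hCas hP hc hinf κ hκ γ _ ι' e he
  obtain ⟨ΩK, Ωp, L, hΩ, hL, h3At⟩ :=
    exists_frame_imcEqOnTreeAt_of_erratumThm11_OPEN W p h11 hE hqp hmq hns hvq hK
      ⟨H.β, H.dvd_sq_sub⟩ Dt.f Dt.isNewformOf κ hκ γ ι' w₀
  exact ⟨ΩK, ((Ωp : unrIntegers p) : ℂ_[p]), PowerSeries.map (R1.unrToCpInt p) L, hΩ,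
    norm_coe_units_unrIntegers p Ωp, R1.isBDPLFunctionInt_map hL, R1.imcEqIntAt_map h3At⟩

end Handshake

/-! ### §2 The `BSD(E,p)` reading on the semistable part of `R1Population` -/

section Pair

variable (W : WeierstrassCurve ℚ) [W.IsElliptic] [W.IsGloballyMinimal] (p : ℕ) [Fact p.Prime]

/-- **`BSD(E,p)` on the semistable part of `R1Population`, from citations** (route R1's equality
record `R1.bsdp_of_bdpValueCoreFrame_of_imcEqCoreFrame_record` with H2 from `h32` and H3∃⁻ from H2 ∧
H3∀′, H3∀′ by §1): for a globally minimal SEMISTABLE elliptic `W/ℚ` and `p` with `R1Population W p` and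
`ord_{s=1}L(E,s) = 1`, `BSDp W p` from the OPEN Literature fact + 8 PUBLISHED + 5 CITED named facts.
CONDITIONAL on an unrefereed claim; nothing booked; closes rung K2 of BirchSwinnertonDyer for no pair
unconditionally. [claim: Castella2018Erratum, status: under-review]
[cite: Castella2018, Thms. 3.1–3.2 (arXiv:1704.06608 p. 9), §5 (p. 12)] [cite: Miller2011LMS, Def. 1.1] -/
theorem bsdp_of_r1Population_of_semistable_of_erratumThm11_OPEN
    (h11 : erratumThm11_exists_isBDPLFunction_isTorsion_charIdeal_eq_OPEN)
    (h32 : thm32_exists_isBDPLFunction_valueAtOne)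
    (hGZ86 : GrossZagier1986_thm_I_7_3) (hGZK : rank_eq_analyticRank_of_analyticRank_le_one)
    (hSk : Skinner2016.thmC_padicValRat_bsd_rank_zero) (hnf : exists_isNewformOf)
    (hCST : CaiShuTian2014.thm11_trivialChar)
    (hFH : friedbergHoffstein_exists_twist_ne_zero_ramifiedAt)
    (hMaz : mazur_not_dvd_maninConstant_of_odd)
    (hPT : ∀ (K : Type) [Field K] [NumberField K], poitouTate_selmerStructure_duality K)
    (hPT2 : ∀ (K : Type) [Field K] [NumberField K], poitouTate_sha_tateDual K)
    (hEP : ∀ (K : Type) [Field K] [NumberField K] (v : HeightOneSpectrum (𝓞 K)),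
      localEulerPoincareCharacteristic (v.adicCompletion K))
    (hcd : fieldCdLE_two_of_numberField)
    (hBr : ∀ (K : Type) [Field K] [NumberField K] (p : ℕ) [Fact p.Prime],
      ZpExtension.decomp_not_le_kerSubgroup_of_isAnticyclotomic K p)
    (hss : Semistable W) (hW : R1Population W p) (hr : W.analyticRank = 1) : BSDp W p :=
  R1.bsdp_of_bdpValueCoreFrame_of_imcEqCoreFrame_record hGZ86 hGZK hSk hnf hCST hFH hMaz hPT hPT2 hEP
    hcd hBr (R1.bdpValueCoreFrameOnTree_of_thm32 h32 hss)
    (fun _ _ _ _ _ Dt H w₀ _P hE _hr hqp hmq hns hvq hK _hCas _hP _hc _hinf κ hκ γ _ ι' _e _he ↦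
      exists_frame_imcEqOnTreeAt_of_erratumThm11_OPEN W p h11 hE hqp hmq hns hvq hK
        ⟨H.β, H.dvd_sq_sub⟩ Dt.f Dt.isNewformOf κ hκ γ ι' w₀)
    hW hr

end Pair

end Summit.BirchSwinnertonDyer.BirchSwinnertonDyer.Theorems

end
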